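/-
COR-CM (cell pub-hodgecm2, stage 2 of the Hodge ladder) — count-neutral kernel combinatorics (seat prover-pub-hodgecm2-b23-g57-0, binder
prover b23, gen 57; lane SYLOW TRANSFER XIX «the odd central factor of an index-two cyclic 2-group: the product datum, the exact law at d₂ = 1,
the sandwich at d₂ = 0», blanket `Census/SylowTransfer*` HOME/INBOX.md l.23357, claim l.26753).  Theorems only (parts XVI–XVII and gen 49ʼs
`Census/IndexTwoCyclic{Law,Dichotomy}` BY NAME); no definition, no certificate, no named fact, no geometry, no `sorry`.  `Interfaces.lean` (C1), every
E term, B01 and `Transposition/*` are untouched.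
HONEST FRAMING: `HC_CM` is NOT proved, here or anywhere in the tree; nothing here is a period or a headline.
-/
import Summits.HodgeConjecture.CorCM.Census.SylowTransferOddCentralRows

/-!
# Sylow transfer, XIX: `(ℤ/2n ⋊_r ℤ/2) × C_p` — the product datum and the laws

For gen 49ʼs index-two cyclic datum `D : IndexTwoCyclic.Datum H c n` (`u` of order `2n`, involution `w`, `w u = uʳ w`) and a group `A` of odd prime
order `p` (generator `a`), the product `H × A` carries the index-two cyclic datum `u' = (u, a)` (order `2np`), `w' = (w, 1)`, `r' ≡ r (mod 2n)`,
`r' ≡ 1 (mod p)` (`exists_prodDatum`, Chinese remainder), and `(c,1) ∈ ⟨u'^{r'+1}⟩ ↔ c ∈ ⟨u^{r+1}⟩` (part XVI §1).  Hence, for EVEN `n`: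

* **`isLeast_card_gfaces_generate_fibreTwo_prod_of_twist`**: `c ∈ ⟨u^{r+1}⟩` (`d₂(H) = 1`: modular, semidihedral, … columns) ⟹
  **`μ(H × A) = φ₂(H × A) = β(H × A) − 1`** (gen 49ʼs twist law on the product datum) — e.g. `SD₁₆ × C₃`: EXACTLY `349879`, `M₁₆ × C₃`: EXACTLY `349707`
  (part XVIIʼs block counts), and every `SD_{2^k} × C_p`, `M_{2^k} × C_p`;
* **`exists_isLeast_prod_of_notMem`**: `c ∉ ⟨u^{r+1}⟩` (`d₂(H) = 0`: the dihedral column, gen 56ʼs mixed twists) ⟹ `β − 2 ≤ μ(H × A) ≤ β − 1` —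
  `D₈ × C₃ = (24,7)`: **`μ ∈ {350222, 350223}`** (`exists_isLeast_dihedralEight_prod_three`), the kernel form of gen 56ʼs first open row.
All [folklore] bookkeeping over [Pohlmann1968, Thm 1] in the reading of [Milne1999, Prop. 2.1].

## References
* [Pohlmann1968] H. Pohlmann, Algebraic cycles on abelian varieties of complex multiplication type, Ann. of Math. 88 (1968), Thm 1.
* [Milne1999] J. S. Milne, Lefschetz motives and the Tate conjecture, Compositio Math. 117 (1999), Prop. 2.1, p. 54.
-/

namespace Summit.HodgeConjecture.CorCM.Census.SylowTransfer

open Finset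
open Summit.HodgeConjecture.CorCM.Prior.AllgGroup.RfwfAllgGroup
open Summit.HodgeConjecture.CorCM.Census.BlockParity
open Summit.HodgeConjecture.CorCM.Census.Coinvariant
open Summit.HodgeConjecture.CorCM.Census.TypeStabiliser
open Summit.HodgeConjecture.CorCM.Census.IndexTwoCyclic

noncomputable section

variable {H A : Type*} [Group H] [Fintype H] [DecidableEq H] [Group A] [Fintype A] [DecidableEq A]
variable {c : H} {n : ℕ} [NeZero n] (D : IndexTwoCyclic.Datum H c n)

/-! ## §1 The product datum -/

omit [DecidableEq H] [DecidableEq A] in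
include D in
/-- **THE PRODUCT DATUM**: `(u, a)`, `(w, 1)` and a Chinese-remainder exponent `r' ≡ r (2n)`, `r' ≡ 1 (p)` form an index-two cyclic datum of level `n·p`
on `H × A` (`|A| = p` an odd prime, `a` of order `p`, `p ∤ 2n`). [folklore] -/
theorem exists_prodDatum (hc2 : c * c = 1) {p : ℕ} (hp : p.Prime) (hp2 : p ≠ 2) (hA : Fintype.card A = p) (hcop : Nat.Coprime (2 * n) p)
    (a : A) (ha : orderOf a = p) :
    ∃ D' : IndexTwoCyclic.Datum (H × A) (c, 1) (n * p),
      D'.u = (D.u, a) ∧ D'.w = (D.w, 1) ∧ D'.r ≡ D.r [MOD 2 * n] ∧ D'.r ≡ 1 [MOD p] := by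
  haveI : NeZero (n * p) := ⟨mul_ne_zero (NeZero.ne n) hp.ne_zero⟩
  have hodd : Odd p := hp.odd_of_ne_two hp2
  obtain ⟨r', hr'n, hr'p⟩ := Nat.chineseRemainder hcop D.r 1
  have hord : orderOf ((D.u, a) : H × A) = 2 * (n * p) := by
    rw [Prod.orderOf_mk, D.hord, ha, hcop.lcm_eq_mul, mul_assoc]
  have hcardG : Nat.card (H × A) = 4 * n * p := by
    rw [Nat.card_eq_fintype_card, Fintype.card_prod, card_eq_four_mul_of_datum D, hA]
  refine ⟨{ u := (D.u, a), w := (D.w, 1), r := r', hun := ?_, hord := hord, hindex := ?_, hw := ?_, hww := ?_, htwist := ?_ },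
    rfl, rfl, hr'n, hr'p⟩
  · rw [Prod.pow_mk, pow_mul, D.hun, pow_eq_self_of_odd hc2 hodd, mul_comm n p, pow_mul, ← ha, pow_orderOf_eq_one, one_pow]
  · have h := (Subgroup.zpowers ((D.u, a) : H × A)).card_mul_index
    rw [Nat.card_zpowers, hord, hcardG] at h
    have hnp : 0 < n * p := Nat.pos_of_ne_zero (NeZero.ne (n * p))
    have : 2 * (n * p) * (Subgroup.zpowers ((D.u, a) : H × A)).index = 2 * (n * p) * 2 := by rw [h]; ring
    exact Nat.eq_of_mul_eq_mul_left (by omega) this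
  · intro hmem
    obtain ⟨k, hk⟩ := Subgroup.mem_zpowers_iff.mp hmem
    have h1 := congrArg Prod.fst hk
    rw [fst_zpow_prod] at h1
    exact D.hw (Subgroup.mem_zpowers_iff.mpr ⟨k, h1⟩)
  · rw [Prod.mk_mul_mk, D.hww, mul_one]; rfl
  · rw [Prod.mk_mul_mk, Prod.pow_mk, Prod.mk_mul_mk, D.htwist, one_mul, mul_one, (pow_eq_pow_iff_modEq.mpr _ : D.u ^ D.r = D.u ^ r')]
    · congr 1
      nth_rewrite 1 [← pow_one a]
      exact pow_eq_pow_iff_modEq.mpr (by rw [ha]; exact hr'p.symm)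
    · rw [D.hord]; exact hr'n.symm

omit [Fintype H] [DecidableEq H] [Fintype A] [DecidableEq A] [NeZero n] in
include D in
/-- Under the product datum, **`(c,1) ∈ ⟨u'^{r'+1}⟩ ↔ c ∈ ⟨u^{r+1}⟩`** (part XVI §1 with the odd order of `a²`). [folklore] -/
theorem prod_mem_zpowers_twist_iff (hc2 : c * c = 1) {p : ℕ} (hp : p.Prime) (hp2 : p ≠ 2) (a : A) (ha : orderOf a = p) {r' : ℕ}
    (hr'n : r' ≡ D.r [MOD 2 * n]) :
    ((c, (1 : A)) : H × A) ∈ Subgroup.zpowers (((D.u, a) : H × A) ^ (r' + 1)) ↔ c ∈ Subgroup.zpowers (D.u ^ (D.r + 1)) := by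
  have hu : D.u ^ (r' + 1) = D.u ^ (D.r + 1) := pow_eq_pow_iff_modEq.mpr (by rw [D.hord]; exact hr'n.add_right 1)
  have hodd : Odd (orderOf (a ^ (r' + 1))) :=
    Odd.of_dvd_nat (by rw [ha]; exact hp.odd_of_ne_two hp2) (orderOf_pow_dvd (r' + 1))
  rw [Prod.pow_mk, hu]
  exact prod_mem_zpowers_prod_iff hc2 _ hodd

/-! ## §2 The laws -/

include D in
/-- **`(ℤ/2n ⋊_r ℤ/2) × C_p` WITH `c ∈ ⟨u^{r+1}⟩` (`n` even): `μ = φ₂`** — gen 49ʼs twist law on the product datum; every `SD_{2^k} × C_p`,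
`M_{2^k} × C_p`, … . [folklore] -/
theorem isLeast_card_gfaces_generate_fibreTwo_prod_of_twist (hc2 : c * c = 1) (hc1 : c ≠ 1) (hn : Even n) {p : ℕ} (hp : p.Prime)
    (hp2 : p ≠ 2) (hA : Fintype.card A = p) (hcop : Nat.Coprime (2 * n) p) (a : A) (ha : orderOf a = p)
    (hr : c ∈ Subgroup.zpowers (D.u ^ (D.r + 1))) :
    IsLeast {m : ℕ | ∃ S : Finset (CMF (H × A) (c, 1) →₀ ℤ), ↑S ⊆ gfaceSet (H × A) (c, 1) (prod_c_mul_c hc2) ∧ S.card = m ∧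
      hodgeSpan ((c, (1 : A)) : H × A) (prod_c_mul_c hc2) ≤
        Submodule.span ℤ (pairSet ((c, (1 : A)) : H × A)) ⊔ Submodule.span ℤ (translates (c, 1) S)}
      (fibreTwo ((c, (1 : A)) : H × A) (prod_c_mul_c hc2)) := by
  haveI : NeZero (n * p) := ⟨mul_ne_zero (NeZero.ne n) hp.ne_zero⟩
  obtain ⟨D', hu, -, hr'n, -⟩ := exists_prodDatum D hc2 hp hp2 hA hcop a ha
  have hr' : ((c, (1 : A)) : H × A) ∈ Subgroup.zpowers (D'.u ^ (D'.r + 1)) := by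
    rw [hu]
    exact (prod_mem_zpowers_twist_iff D hc2 hp hp2 a ha hr'n).mpr hr
  exact isLeast_card_gfaces_generate_fibreTwo_of_twist D' (prod_c_mul_c hc2) (prod_c_ne_one hc1) (hn.mul_right p) hr'

include D in
/-- **… block currency: `μ = β(H × A) − 1`.** [folklore] -/
theorem isLeast_card_gfaces_generate_prod_of_twist (hc2 : c * c = 1) (hc1 : c ≠ 1) (hn : Even n) {p : ℕ} (hp : p.Prime)
    (hp2 : p ≠ 2) (hA : Fintype.card A = p) (hcop : Nat.Coprime (2 * n) p) (a : A) (ha : orderOf a = p)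
    (hr : c ∈ Subgroup.zpowers (D.u ^ (D.r + 1))) :
    IsLeast {m : ℕ | ∃ S : Finset (CMF (H × A) (c, 1) →₀ ℤ), ↑S ⊆ gfaceSet (H × A) (c, 1) (prod_c_mul_c hc2) ∧ S.card = m ∧
      hodgeSpan ((c, (1 : A)) : H × A) (prod_c_mul_c hc2) ≤
        Submodule.span ℤ (pairSet ((c, (1 : A)) : H × A)) ⊔ Submodule.span ℤ (translates (c, 1) S)}
      (Fintype.card (Block ((c, (1 : A)) : H × A)) - 1) := by
  haveI : NeZero (n * p) := ⟨mul_ne_zero (NeZero.ne n) hp.ne_zero⟩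
  obtain ⟨D', hu, -, hr'n, -⟩ := exists_prodDatum D hc2 hp hp2 hA hcop a ha
  have hr' : ((c, (1 : A)) : H × A) ∈ Subgroup.zpowers (D'.u ^ (D'.r + 1)) := by
    rw [hu]
    exact (prod_mem_zpowers_twist_iff D hc2 hp hp2 a ha hr'n).mpr hr
  exact isLeast_card_gfaces_generate_of_twist D' (prod_c_mul_c hc2) (prod_c_ne_one hc1) (hn.mul_right p) hr'

include D in
/-- **`(ℤ/2n ⋊_r ℤ/2) × C_p` WITH `c ∉ ⟨u^{r+1}⟩` (the mixed twists of gen 56 and the dihedral column times `C_p`): `β − 2 ≤ μ ≤ β − 1`.**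
[folklore] -/
theorem exists_isLeast_prod_of_notMem (hc2 : c * c = 1) (hc1 : c ≠ 1) {p : ℕ} (hp : p.Prime) (hp2 : p ≠ 2) (hA : Fintype.card A = p)
    (hcop : Nat.Coprime (2 * n) p) (a : A) (ha : orderOf a = p) (hr : c ∉ Subgroup.zpowers (D.u ^ (D.r + 1))) :
    ∃ m : ℕ, Fintype.card (Block ((c, (1 : A)) : H × A)) ≤ m + 2 ∧ m + 1 ≤ Fintype.card (Block ((c, (1 : A)) : H × A)) ∧
      IsLeast {m : ℕ | ∃ S : Finset (CMF (H × A) (c, 1) →₀ ℤ), ↑S ⊆ gfaceSet (H × A) (c, 1) (prod_c_mul_c hc2) ∧ S.card = m ∧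
        hodgeSpan ((c, (1 : A)) : H × A) (prod_c_mul_c hc2) ≤
          Submodule.span ℤ (pairSet ((c, (1 : A)) : H × A)) ⊔ Submodule.span ℤ (translates (c, 1) S)} m := by
  haveI : NeZero (n * p) := ⟨mul_ne_zero (NeZero.ne n) hp.ne_zero⟩
  obtain ⟨D', hu, -, hr'n, -⟩ := exists_prodDatum D hc2 hp hp2 hA hcop a ha
  have hr' : ((c, (1 : A)) : H × A) ∉ Subgroup.zpowers (D'.u ^ (D'.r + 1)) := by
    rw [hu]
    exact fun h => hr ((prod_mem_zpowers_twist_iff D hc2 hp hp2 a ha hr'n).mp h)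
  exact exists_isLeast_of_notMem D' (prod_c_mul_c hc2) (prod_c_ne_one hc1) hr'

/-! ## §3 Rows at level `4` over `C₃` -/

section Rows

variable {c : H} (D : IndexTwoCyclic.Datum H c 4)

omit [DecidableEq A] in
/-- A group of order `3` has an element of order `3`. [folklore] -/
theorem exists_orderOf_eq_three (hA : Fintype.card A = 3) : ∃ a : A, orderOf a = 3 := by
  haveI : Fact (Nat.Prime 3) := ⟨Nat.prime_three⟩
  exact exists_prime_orderOf_dvd_card 3 (by rw [hA])

/-- **Row `SD₁₆ × C₃`: EXACTLY `349879` faces** (`μ = φ₂ = β − 1`). [folklore] -/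
theorem isLeast_card_gfaces_generate_semidihedralSixteen_prod_three (hc2 : c * c = 1) (hc1 : c ≠ 1)
    (hr : ((D.r + 1 : ℕ) : ZMod (2 * 4)) = 4) (hA : Fintype.card A = 3) :
    IsLeast {m : ℕ | ∃ S : Finset (CMF (H × A) (c, 1) →₀ ℤ), ↑S ⊆ gfaceSet (H × A) (c, 1) (prod_c_mul_c hc2) ∧ S.card = m ∧
      hodgeSpan ((c, (1 : A)) : H × A) (prod_c_mul_c hc2) ≤
        Submodule.span ℤ (pairSet ((c, (1 : A)) : H × A)) ⊔ Submodule.span ℤ (translates (c, 1) S)} 349879 := by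
  obtain ⟨a, ha⟩ := exists_orderOf_eq_three (A := A) hA
  have hmem : c ∈ Subgroup.zpowers (D.u ^ (D.r + 1)) := by
    have h4 : D.u ^ (D.r + 1) = D.u ^ 4 := by
      rw [D.pow_eq_pow_iff]
      exact_mod_cast hr
    rw [h4, D.hun]
    exact Subgroup.mem_zpowers c
  have h := isLeast_card_gfaces_generate_prod_of_twist (A := A) D hc2 hc1 ⟨2, rfl⟩ Nat.prime_three (by norm_num) hA (by norm_num) a ha hmem
  rwa [card_block_semidihedralSixteen_prod_three D hc2 hc1 hr hA] at h

/-- **Row `M₁₆ × C₃`: EXACTLY `349707` faces** (`μ = φ₂ = β − 1`). [folklore] -/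
theorem isLeast_card_gfaces_generate_modularSixteen_prod_three (hc2 : c * c = 1) (hc1 : c ≠ 1)
    (hr : ((D.r + 1 : ℕ) : ZMod (2 * 4)) = 6) (hA : Fintype.card A = 3) :
    IsLeast {m : ℕ | ∃ S : Finset (CMF (H × A) (c, 1) →₀ ℤ), ↑S ⊆ gfaceSet (H × A) (c, 1) (prod_c_mul_c hc2) ∧ S.card = m ∧
      hodgeSpan ((c, (1 : A)) : H × A) (prod_c_mul_c hc2) ≤
        Submodule.span ℤ (pairSet ((c, (1 : A)) : H × A)) ⊔ Submodule.span ℤ (translates (c, 1) S)} 349707 := by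
  obtain ⟨a, ha⟩ := exists_orderOf_eq_three (A := A) hA
  have hmem : c ∈ Subgroup.zpowers (D.u ^ (D.r + 1)) := by
    have h6 : D.u ^ (D.r + 1) = D.u ^ 6 := by
      rw [D.pow_eq_pow_iff]
      exact_mod_cast hr
    rw [h6]
    refine Subgroup.mem_zpowers_iff.mpr ⟨(2 : ℕ), ?_⟩
    rw [zpow_natCast, ← pow_mul, show 6 * 2 = 2 * 4 + 4 by norm_num, pow_add, ← D.hord, pow_orderOf_eq_one, one_mul, D.hun]
  have h := isLeast_card_gfaces_generate_prod_of_twist (A := A) D hc2 hc1 ⟨2, rfl⟩ Nat.prime_three (by norm_num) hA (by norm_num) a ha hmem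
  rwa [card_block_modularSixteen_prod_three D hc2 hc1 hr hA] at h

/-- **Row `D₈ × C₃ = (24,7)`: `μ ∈ {350222, 350223}`** — the kernel form of gen 56ʼs first open mixed twist (`φ₂ = 350222`, part XVII). [folklore] -/
theorem exists_isLeast_dihedralEight_prod_three (hc2 : c * c = 1) (hc1 : c ≠ 1)
    (hr : ((D.r + 1 : ℕ) : ZMod (2 * 4)) = 0) (hA : Fintype.card A = 3) :
    ∃ m : ℕ, (m = 350222 ∨ m = 350223) ∧
      IsLeast {m : ℕ | ∃ S : Finset (CMF (H × A) (c, 1) →₀ ℤ), ↑S ⊆ gfaceSet (H × A) (c, 1) (prod_c_mul_c hc2) ∧ S.card = m ∧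
        hodgeSpan ((c, (1 : A)) : H × A) (prod_c_mul_c hc2) ≤
          Submodule.span ℤ (pairSet ((c, (1 : A)) : H × A)) ⊔ Submodule.span ℤ (translates (c, 1) S)} m := by
  obtain ⟨a, ha⟩ := exists_orderOf_eq_three (A := A) hA
  have hnot : c ∉ Subgroup.zpowers (D.u ^ (D.r + 1)) := by
    have h0 : D.u ^ (D.r + 1) = 1 := by
      rw [← pow_zero D.u, D.pow_eq_pow_iff, Nat.cast_zero]
      exact hr
    rw [h0, Subgroup.zpowers_one_eq_bot, Subgroup.mem_bot]
    exact hc1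
  obtain ⟨m, h1, h2, hm⟩ := exists_isLeast_prod_of_notMem (A := A) D hc2 hc1 Nat.prime_three (by norm_num) hA (by norm_num) a ha hnot
  rw [card_block_dihedralEight_prod_three D hc2 hc1 hr hA] at h1 h2
  exact ⟨m, by omega, hm⟩

end Rows

end

end Summit.HodgeConjecture.CorCM.Census.SylowTransfer
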